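/-
Copyright: cell pub-balaban-gaps (YM BLITZ Y1, track G1), seat g1-p2 GEN 6 (unit `pub-balaban-gaps-g1-p2`).  Row (D4) NODE O,
OBJECT ∕ MECHANISM level: THE TAIL-TOLERANT END — Theorem 3.10 at one scale in print's bookkeeping for `Δ′(u) = 1 + K′₀(u) + K′₁(u)`
with `K′₀` of finite range and `K′₁` an exponentially decaying TAIL, local inverses CONSTRUCTED, the `s ≡ 1` kernel `= Δ′(u)⁻¹`
with every invertibility letter DISCHARGED.  HONEST FRAMING: packaging at MODEL generality over hypothesis SHAPES (letters on `Δ′`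
itself); nothing of Bałaban's constructed or asserted; (D4) NOT discharged (instance 0∕1); NOT BetaPertH, NOT continuum, NOT Clay.
-/
import Summits.QuantumFields.BalabanUV.Gaps.D4WalkBlockAccretiveRate
import Summits.QuantumFields.BalabanUV.Gaps.D4WalkBlockStepUnit
import Summits.QuantumFields.BalabanUV.Gaps.D4WalkBlockTail

/-!
# `Gaps.D4WalkBlockAccretiveTail` — Thm 3.10 at one scale for `Δ′ = 1 + K′_{≤r₁} + K′_tail`: the (U)-road END without the
# finite-range letter on the whole operator (cell pub-balaban-gaps, seat g1-p2 GEN 6)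

HONEST DEPENDENCY (cell pub-balaban, verbatim): continuum YM on T⁴ ⇐ BetaPertH ∧ nine spine estimates (0/9 proved);
BetaPertH ⇐ (D1) ∧ (D4) ∧ CAP+tail.

WHY.  File 47 (`Gaps/D4WalkBlockAccretiveDecay.blockWalkExpansion_accretive_print`) runs [B9] Thm 3.10 at one scale from letters on
`Δ′(u) = 1 + K′(u)` alone — but one of them is `hKrange`: `K′` of FINITE range `r₁`.  Bałaban's unit-lattice operators have
exponential TAILS ([B9] Thm 3.2 (3.48) p. 398), so for them `K′ = K′₀ + K′₁`, `K′₀ := 1_{ds ≤ r₁}K′` (range `r₁`, block bound `C_K`),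
`K′₁ :=` the tail, with ONE decaying block letter `‖K′₁(u)‖_{y,y′} ≤ λ₁e^{−ρ_Vd₁(y,y′)}`, `λ₁ = O(e^{−(δ₀−ρ_V)r₁})` SMALL for `r₁`
large (RESIDUE (D4) v1.15 V62 (2) ∕ V67 J47-1: «tail split NOT ATTEMPTED»).  Print's device for the small remainder is the resolvent
series on top of the expansion in hand ([B9] (3.96) p. 411, (3.130) p. 421–422), typed abstractly in file 49
(`Gaps/D4WalkBlockTail.blockWalkExpansion_tail`).  THIS FILE composes, BY NAME:
* (the PINNED-RATE twin of 47's END, `Gaps/D4WalkBlockAccretiveRate.accretive_print_rate`, is the input: the walk rate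
  `ρ₀ − 3μ − κ₁P∕r₀` in the type instead of `∃ ρ′`);
* §1 the one-line transfer of UNIFORM CONJUGATED COERCIVITY from `Δ′` to its finite-range part `Δ′ − K′₁` under conjugated Schur
  sums of the tail (36's `norm_conjForm_le_schur`): the instance supplies coercivity of the WHOLE operator ([B9] Thm 3.11), the
  construction of the local inverses wants it for the truncation;
* §2 `isUnit_det_one_add_mul_of_small`: `1 + K′₁W` is a unit once `λ₁c_μK̄_Wc_μ < 1` (Gershgorin, 48's
  `isUnit_det_one_sub_of_rowSum_lt_one`, with the kernel's block bound from 49's `blockNorm_kernel_le`) — the resolvent's `hunit`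
  DISCHARGED in the margin's own currency; `one_le_rowSum_const` (`c_μ ≥ 1`);
* §3 THE END `blockWalkExpansion_accretive_tail`: 47's letters for `K′₀` (holomorphy, range `r₁`, block bound, UNIFORM CONJUGATED
  COERCIVITY of `1 + K′₀`, Lipschitz partition, geometry, cube row sum, decoration data; rates `5μ + κ₁P∕r₀ ≤ ε₀`, `4μ ≤ κ₀`,
  `κ₀ + μ ≤ ρ₀ − ε₀`), the tail letters for `K′₁` (holomorphy, `(λ₁, ρ_V)` with `ρ_V ≥ ρ₀ − 2μ − κ₁P∕r₀`), 47's margin `q < 1` and the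
  tail margin `q_t = c_μ(c_μ·1·(1·(c_μλ₁K_Wc_μ))c_μ)c_μ < 1` for any `K_W` above the one-scale constant ⟹ an s-decorated family
  `W(s,u)` with `W(1,u) = (1 + K′₀(u))⁻¹` such that `W(s,u)(1 + K′₁(u)W(s,u))⁻¹` is a `BlockWalkExpansion` at
  `(ε₀ − 5μ − κ₁P∕r₀, κ₀ − 4μ)`, walk rate `ρ₀ − 5μ − κ₁P∕r₀`, constant `c_μK_W(1−q_t)⁻¹c_μ`, σ-region `X`, and — given `Σh_□² = 1`
  and the covering multiplicity `n_B` with `n_Bn_Cλ_R < 1` — its `s ≡ 1` kernel IS `(1 + K′₀(u) + K′₁(u))⁻¹ = Δ′(u)⁻¹`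
  (`accretive_tail_one_eq_inv`: 48 + §2 + 49's `tail_kernel_one`).
So the (U)-road's operator letters for Bałaban's `Δ^{(k)}(𝐔)` now read: k-free uniform conjugated coercivity + a split into a
finite-range part and a tail with a small decaying block letter — the (3.48) SHAPE; the finite-range letter on the whole operator is
gone.  Value: kernel-checked bookkeeping; nothing of Bałaban's asserted; words of row (D4) UNCHANGED.

References: T. Bałaban, Comm. Math. Phys. 99 (1985) 389–434 [B9], Thms 3.1–3.2 (3.42) p.397, (3.48) p.398, Cor 3.6 p.408,
Thm 3.7 (3.87)–(3.90) p.409, Cor 3.8 p.410, (3.95)–(3.96) p.411, Thm 3.10 (3.107)–(3.108) p.416, Thm 3.11 p.416, (3.130)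
p.421–422; Comm. Math. Phys. 116 (1988) 1–22 [II], p.3, (1.11) p.5, p.13, p.15, (2.16) p.16.
-/

noncomputable section

namespace Summit.QuantumFields.BalabanUV.Gaps.D4WalkBlockAccretiveTail

open Metric Set Finset
open Literature.MathematicalPhysics.QuantumFieldTheory.Balaban1983to89
open Literature.MathematicalPhysics.QuantumFieldTheory.Balaban1983to89.B9SectDWalk (DomBy)
open Literature.MathematicalPhysics.QuantumFieldTheory.Balaban1983to89.B9Thm34Ext (toB6)
open Literature.MathematicalPhysics.QuantumFieldTheory.Balaban1983to89.B9Thm37GlueTorus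
  (torusGeom tdist1 tdist1_nonneg tdist1_self hdnn_torusGeom)
open Literature.MathematicalPhysics.QuantumFieldTheory.Balaban1983to89.TreeLengthTorus (TPt)
open Literature.MathematicalPhysics.QuantumFieldTheory.Balaban1983to89.B5TorusCover (UT)
open Literature.MathematicalPhysics.QuantumFieldTheory.Balaban1983to89.B11SectG (RowSum)
open Literature.MathematicalPhysics.QuantumFieldTheory.Balaban1983to89.B5Prop11Lower (nsq nsq_nonneg)
open Literature.MathematicalPhysics.QuantumFieldTheory.Balaban1983to89.B13DomainKernelWalks (DomainTerms)
open Summit.QuantumFields.BalabanUV.Gaps.D4WalkBlock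
  (rowMass blockNorm blockNorm_nonneg rowMass_le_blockNorm blockNorm_mul_le BlockWalkExpansion)
open Summit.QuantumFields.BalabanUV.Gaps.D4WalkBlockCommutator (comm_blocks_subset)
open Summit.QuantumFields.BalabanUV.Gaps.D4WalkBlockLocalInverse
  (cRow cCol norm_conjForm_le_schur differentiableOn_locInv locInv_letters)
open Summit.QuantumFields.BalabanUV.Gaps.D4WalkBlockLocalDecay (IsDomainLocalBD)
open Summit.QuantumFields.BalabanUV.Gaps.D4WalkBlockDecorate (decTerm decKernel)
open Summit.QuantumFields.BalabanUV.Gaps.D4WalkBlockParametrixDecay (isDomainLocalBD_step)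
open Summit.QuantumFields.BalabanUV.Gaps.D4WalkBlockAccretiveDecay (blockNorm_locInv_le_decay blockNorm_comm_le_decay)
open Summit.QuantumFields.BalabanUV.Gaps.D4WalkBlockStepUnit
  (isUnit_det_one_sub_of_rowSum_lt_one rowSum_eq_sum_rowMass accretive_print_one_eq_inv_of_small)
open Summit.QuantumFields.BalabanUV.Gaps.D4WalkBlockTail (blockNorm_kernel_le blockWalkExpansion_tail tail_kernel_one)
open Summit.QuantumFields.BalabanUV.Gaps.D4WalkBlockAccretiveRate (accretive_print_rate)
open Summit.QuantumFields.BalabanUV.T4Continuum.Spine.NE5.TwoRunPencilDomains (withOp)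
open Summit.QuantumFields.BalabanUV.Beta.UnitLatticeWalkInversion (Hd Pj)
open Summit.QuantumFields.BalabanUV.Beta.UnitLatticeLocalInverse (compress extend)
open Summit.QuantumFields.BalabanUV.Beta.AccretiveCombesThomas (conjForm conjForm_add conjForm_smul isUnit_of_conjCoercive)

variable {ν : ℕ} {K : Fin ν → ℕ} [∀ i, NeZero (K i)]
variable {n : Type} [Fintype n] [DecidableEq n]

/-! ## §1. Uniform conjugated coercivity passes from `Δ′` to its finite-range part under Schur sums of the tail -/

section Coercive

variable {ι : Type*} [Fintype ι]

/-- **COERCIVITY OF THE TRUNCATION FROM COERCIVITY OF THE WHOLE**: if `A(u)` is conjugated-coercive `m` along every column weight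
`d(·,j)` uniformly on `S`, and the tail `B(u)` has conjugated row ∕ column sums `≤ c_r`, `≤ c_c` there, then `A(u) − B(u)` is
conjugated-coercive `m − ½(c_r + c_c)` uniformly on `S` (36's Schur test `norm_conjForm_le_schur`). [folklore] -/
theorem conjCoercive_sub_uniform_of_schur {E : Type*} {A B : E → Matrix ι ι ℂ} {S : Set E} (d : ι → ι → ℝ) {κ m cr cc : ℝ}
    (hA : ∀ u ∈ S, ∀ j, ∀ z : ι → ℂ, m * nsq z ≤ (conjForm (A u) κ (fun e => d e j) z).re)
    (hr : ∀ u ∈ S, ∀ j e, cRow (B u) κ (fun e => d e j) e ≤ cr)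
    (hcc : ∀ u ∈ S, ∀ j e', cCol (B u) κ (fun e => d e j) e' ≤ cc) :
    ∀ u ∈ S, ∀ j, ∀ z : ι → ℂ, (m - (cr + cc) / 2) * nsq z ≤ (conjForm (A u - B u) κ (fun e => d e j) z).re := by
  intro u hu j z
  have hsplit : A u - B u = A u + (-1 : ℂ) • B u := by rw [sub_eq_add_neg, neg_one_smul]
  have hB := norm_conjForm_le_schur (B u) κ (fun e => d e j) (hr u hu j) (hcc u hu j) z
  have hre : |(conjForm (B u) κ (fun e => d e j) z).re| ≤ (cr + cc) / 2 * nsq z :=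
    (Complex.abs_re_le_norm _).trans hB
  rw [hsplit, conjForm_add, conjForm_smul, Complex.add_re]
  have h1 := hA u hu j z
  have h2 : ((-1 : ℂ) * conjForm (B u) κ (fun e => d e j) z).re = -(conjForm (B u) κ (fun e => d e j) z).re := by simp
  rw [h2]
  have h3 := (abs_le.1 hre).2
  nlinarith [nsq_nonneg z]

/-- The END's shape: coercivity `m` of `Δ′(u) = 1 + K′₀(u) + K′₁(u)` and conjugated Schur sums `(c_r, c_c)` of the tail `K′₁` give
coercivity `m − ½(c_r + c_c)` of the finite-range part `1 + K′₀(u)`, uniformly on the ball. [folklore] -/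
theorem hcoer_trunc_of_full [DecidableEq ι] {E : Type*} [NormedAddCommGroup E] {K0 K1 : E → Matrix ι ι ℂ} {R : ℝ}
    (d : ι → ι → ℝ) {κ m cr cc : ℝ}
    (hfull : ∀ u ∈ ball (0 : E) R, ∀ j, ∀ z : ι → ℂ, m * nsq z ≤ (conjForm (1 + K0 u + K1 u) κ (fun e => d e j) z).re)
    (hr : ∀ u ∈ ball (0 : E) R, ∀ j e, cRow (K1 u) κ (fun e => d e j) e ≤ cr)
    (hcc : ∀ u ∈ ball (0 : E) R, ∀ j e', cCol (K1 u) κ (fun e => d e j) e' ≤ cc) :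
    ∀ u ∈ ball (0 : E) R, ∀ j, ∀ z : ι → ℂ, (m - (cr + cc) / 2) * nsq z ≤ (conjForm (1 + K0 u) κ (fun e => d e j) z).re := by
  intro u hu j z
  have h := conjCoercive_sub_uniform_of_schur (A := fun u => 1 + K0 u + K1 u) (B := K1) d hfull hr hcc u hu j z
  simpa [add_sub_cancel_right] using h

end Coercive

/-! ## §2. The resolvent's `hunit` from the margin: `1 + V·W` is a unit once `λ_Vc_μK̄_Wc_μ < 1` -/

section Unit

omit [DecidableEq n] in
/-- The cube row-sum constant is at least one (the diagonal term). [folklore] -/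
theorem one_le_rowSum_const {μ cμ : ℝ} (hrow : RowSum (toB6 (torusGeom K 0 0 0) 0 True) μ cμ) (y : UT K) : 1 ≤ cμ := by
  have h := hrow y
  have h1 : Real.exp (-(μ * tdist1 K y y)) ≤ ∑ y' : UT K, Real.exp (-(μ * tdist1 K y y')) :=
    Finset.single_le_sum (f := fun y' => Real.exp (-(μ * tdist1 K y y'))) (fun _ _ => Real.exp_nonneg _) (Finset.mem_univ y)
  rw [tdist1_self, mul_zero, neg_zero, Real.exp_zero] at h1
  exact h1.trans h

omit [DecidableEq n] in
/-- Row sums at any rate above `μ` are below `c_μ`. [folklore] -/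
theorem sum_exp_le_of_rowSum {μ cμ ρ : ℝ} (hrow : RowSum (toB6 (torusGeom K 0 0 0) 0 True) μ cμ) (hμρ : μ ≤ ρ) (y : UT K) :
    ∑ y' : UT K, Real.exp (-(ρ * tdist1 K y y')) ≤ cμ :=
  (Finset.sum_le_sum fun y' _ => Real.exp_le_exp.2 (by
    have h0 : (0 : ℝ) ≤ tdist1 K y y' := tdist1_nonneg y y'
    show -(ρ * tdist1 K y y') ≤ -(μ * tdist1 K y y')
    nlinarith)).trans (hrow y)

/-- **`1 + V·W` IS A UNIT FROM BLOCK LETTERS** (Gershgorin): `‖V‖_{y,y″} ≤ λ_Ve^{−ρ_Vd₁}`, `‖W‖_{y″,y′} ≤ K̄_We^{−κ_Wd₁}`, the cube row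
sum `(μ, c_μ)` with `μ ≤ ρ_V`, `μ ≤ κ_W`, and `λ_Vc_μK̄_Wc_μ < 1` ⟹ every absolute row sum of `V·W` is `< 1`, so `det(1 + V·W)` is a
unit — the resolvent's invertibility in the margin's own currency ([B9] p.422 «for α₀ sufficiently small»). [cite: Balaban1985BackgroundPropagators, (3.130) p.421, p.422] -/
theorem isUnit_det_one_add_mul_of_small (cubn : n → UT K) (V W : Matrix n n ℂ) {lamV ρV KW κW μ cμ : ℝ}
    (hlam : 0 ≤ lamV) (hKW : 0 ≤ KW)
    (hV : ∀ y y', blockNorm cubn cubn V y y' ≤ lamV * Real.exp (-(ρV * tdist1 K y y')))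
    (hW : ∀ y y', blockNorm cubn cubn W y y' ≤ KW * Real.exp (-(κW * tdist1 K y y')))
    (hrow : RowSum (toB6 (torusGeom K 0 0 0) 0 True) μ cμ) (hμρ : μ ≤ ρV) (hμκ : μ ≤ κW)
    (hsmall : lamV * cμ * (KW * cμ) < 1) : IsUnit (1 + V * W).det := by
  have key : ∀ i, ∑ j, ‖(-(V * W)) i j‖ < 1 := by
    intro i
    have hcμ : 0 ≤ cμ := zero_le_one.trans (one_le_rowSum_const hrow (cubn i))
    calc ∑ j, ‖(-(V * W)) i j‖ = ∑ j, ‖(V * W) i j‖ := by simp only [Matrix.neg_apply, norm_neg]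
      _ = ∑ y', rowMass cubn (V * W) i y' := rowSum_eq_sum_rowMass cubn (V * W) i
      _ ≤ ∑ y', blockNorm cubn cubn (V * W) (cubn i) y' :=
          Finset.sum_le_sum fun y' _ => rowMass_le_blockNorm cubn cubn (V * W) i y'
      _ ≤ ∑ y', ∑ y'', blockNorm cubn cubn V (cubn i) y'' * blockNorm cubn cubn W y'' y' :=
          Finset.sum_le_sum fun y' _ => blockNorm_mul_le cubn cubn cubn V W (cubn i) y'
      _ ≤ ∑ y', ∑ y'', (lamV * Real.exp (-(ρV * tdist1 K (cubn i) y''))) * (KW * Real.exp (-(κW * tdist1 K y'' y'))) :=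
          Finset.sum_le_sum fun y' _ => Finset.sum_le_sum fun y'' _ =>
            mul_le_mul (hV _ _) (hW _ _) (blockNorm_nonneg _ _ _ _ _) (by positivity)
      _ = ∑ y'', (lamV * Real.exp (-(ρV * tdist1 K (cubn i) y''))) *
            ∑ y', KW * Real.exp (-(κW * tdist1 K y'' y')) := by
          rw [Finset.sum_comm]; exact Finset.sum_congr rfl fun y'' _ => by rw [Finset.mul_sum]
      _ ≤ ∑ y'', (lamV * Real.exp (-(ρV * tdist1 K (cubn i) y''))) * (KW * cμ) := by
          refine Finset.sum_le_sum fun y'' _ => mul_le_mul_of_nonneg_left ?_ (by positivity)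
          rw [← Finset.mul_sum]
          exact mul_le_mul_of_nonneg_left (sum_exp_le_of_rowSum hrow hμκ y'') hKW
      _ = lamV * (∑ y'', Real.exp (-(ρV * tdist1 K (cubn i) y''))) * (KW * cμ) := by rw [Finset.mul_sum, Finset.sum_mul]
      _ ≤ lamV * cμ * (KW * cμ) := by
          have h1 := sum_exp_le_of_rowSum hrow hμρ (cubn i)
          have hKc : 0 ≤ KW * cμ := by positivity
          exact mul_le_mul_of_nonneg_right (mul_le_mul_of_nonneg_left h1 hlam) hKc
      _ < 1 := hsmall
  have h := isUnit_det_one_sub_of_rowSum_lt_one (-(V * W)) key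
  rwa [sub_neg_eq_add] at h

end Unit

/-! ## §3. THE END: Theorem 3.10 at one scale for `Δ′ = 1 + K′₀ + K′₁`, local inverses constructed, tail resummed -/

section End

variable {d N' : ℕ}
variable {E : Type*} [NormedAddCommGroup E] [NormedSpace ℂ E]

omit [DecidableEq n] in
/-- Monotonicity of the shape in the constant (the reduced-rate partial sums are only asked to be below `K̄e^{−κd₁}`). [folklore] -/
theorem blockWalkExpansion_mono_const {p : Type} [Fintype p] {c : B13.Consts} {cub : p → UT K} {cubn : n → UT K}
    {K2 : (TPt d N' → ℂ) → E → Matrix p n ℂ} {X : Finset (UT K)} {R ε kap Kbar Kbar' : ℝ}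
    {W : Type} {T2 : W → (TPt d N' → ℂ) → E → Matrix p n ℂ} {SX : Set W} {A : W → ℝ} {D : W → UT K → UT K → ℝ} {ρ : ℝ}
    (h : BlockWalkExpansion c cub cubn K2 X R ε kap Kbar T2 SX A D ρ) (hle : Kbar ≤ Kbar') :
    BlockWalkExpansion c cub cubn K2 X R ε kap Kbar' T2 SX A D ρ where
  hasSum := h.hasSum
  termAnalytic := h.termAnalytic
  majB := h.majB
  majSum := h.majSum.mono fun _ _ => mul_le_mul_of_nonneg_right hle (Real.exp_nonneg _)
  indep := h.indep
  through := h.through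
  A_nonneg := h.A_nonneg
  D_nonneg := h.D_nonneg

variable {L₀ : DomainTerms d N' ν K n n E} {h : L₀.B → n → ℝ} {Es : L₀.B → Finset n} {K0 K1 : E → Matrix n n ℂ}
variable {ds : n → n → ℝ}
variable {c₀ c : B13.Consts} {cubn : n → UT K} {X : Finset (UT K)} {R CK M m κc κ' cs' r₁ r lam1 ρV KW : ℝ} {nD nC nB : ℕ}
variable {ρ₀ ε₀ κ₀ μ cμ : ℝ}

/-- **THEOREM 3.10 AT ONE SCALE FOR `Δ′(u) = 1 + K′₀(u) + K′₁(u)` — FINITE-RANGE PART EXPANDED, TAIL RESUMMED.**  Data: 47's letters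
for the finite-range part `K′₀` (`L₀` an untagged domain skeleton with geometry `(r, n_D, n_C)`; partition `{h_□}` with `|h| ≤ 1`,
`1∕M`-Lipschitz in the symmetric site pseudo-distance `ds`, supports `Es □` with `r₁`-neighbourhood cubes in `dom □`; `K′₀` holomorphic,
range `r₁`, block bound `C_K`; `1 + K′₀(u)` CONJUGATED-COERCIVE `m > 0` at rate `κ_c` along every column weight uniformly on the ball
(§2 turns coercivity of `Δ′` itself into this); comparison `ρ₀d₁ ≤ κ′ds`, residual site row sum `c_s′`; cube row sum `(μ, c_μ)`;
rates `0 ≤ μ`, `3μ ≤ ε₀`, `4μ ≤ κ₀`, `κ₀ + μ ≤ ρ₀ − ε₀`; 47's margin `q < 1`; decoration data with the shift `κ₁P∕r₀ ≤ ε₀ − 5μ`), the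
TAIL `K′₁` (holomorphic, ONE decaying block letter `(λ₁, ρ_V)` with `ρ_V ≥ ρ₀ − 2μ − κ₁P∕r₀`), any `K_W` above the one-scale constant,
and the TAIL MARGIN `q_t = c_μ(c_μ·1·(1·(c_μλ₁K_Wc_μ))c_μ)c_μ < 1`.  Conclusion: an s-decorated family `W(s,u)` — 47's expansion of
the constructed local inverses of `1 + K′₀`, `W(1,u) = S(u)(1 − R(u))⁻¹`, blocks `≤ K_We^{−(κ₀−2μ)d₁}` at `s ≡ 1` — such that
`W(s,u)·(1 + K′₁(u)W(s,u))⁻¹` is a `BlockWalkExpansion` at window `ε₀ − 3μ − κ₁P∕r₀ − 2μ`, torus rate `κ₀ − 2μ − 2μ`, walk rate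
`ρ₀ − 3μ − κ₁P∕r₀ − 2μ`, constant `c_μK_W(1−q_t)⁻¹c_μ`, σ-region `X`, dominating distances.  Composition BY NAME: `accretive_print_rate` → 49.
[cite: Balaban1985BackgroundPropagators, Thms 3.1–3.2 (3.42) p.397, (3.48) p.398, Cor 3.6 p.408, Thm 3.7 (3.87)–(3.90) p.409, Cor 3.8 p.410, (3.95)–(3.96) p.411, Thm 3.10 (3.107)–(3.108) p.416, (3.130) p.421, p.422; Balaban1988RG2Cluster, p.3, (1.11) p.5, p.13, p.15] -/
theorem blockWalkExpansion_accretive_tail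
    (hanchor : ∀ b, L₀.anchor b ∈ L₀.dom b) (hdiam : ∀ b, ∀ z ∈ L₀.dom b, ∀ z' ∈ L₀.dom b, tdist1 K z z' ≤ r)
    (hJ0 : ∀ b, L₀.J b = ∅) (hmult : ∀ z : UT K, (Finset.univ.filter fun b => L₀.anchor b = z).card ≤ nD)
    (hsupp : ∀ b y, y ∉ Es b → h b y = 0) (habs : ∀ b y, |h b y| ≤ 1) (hE : ∀ b y, y ∈ Es b → cubn y ∈ L₀.dom b)
    (hKan : ∀ i j, DifferentiableOn ℂ (fun u => K0 u i j) (ball (0 : E) R))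
    (hKbd : ∀ u ∈ ball (0 : E) R, ∀ y y', blockNorm cubn cubn (K0 u) y y' ≤ CK) (hCK : 0 ≤ CK)
    (hM : 0 < M) (hr₁ : 0 ≤ r₁) (hsymm : ∀ i j, ds i j = ds j i) (hd0 : ∀ j, ds j j = 0)
    (hLip : ∀ b i j, |h b i - h b j| ≤ ds i j / M) (hKrange : ∀ u i j, K0 u i j ≠ 0 → ds i j ≤ r₁)
    (hdomE : ∀ b i, (∃ k ∈ Es b, ds i k ≤ r₁) → cubn i ∈ L₀.dom b)
    (hcard : ∀ b, (L₀.dom b).card ≤ nC)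
    (hm : 0 < m) (hκc : 0 ≤ κc)
    (hcoer : ∀ u ∈ ball (0 : E) R, ∀ j, ∀ z : n → ℂ, m * nsq z ≤ (conjForm (1 + K0 u) κc (fun e => ds e j) z).re)
    (hκ' : 0 ≤ κ') (hcmp : ∀ i j, ρ₀ * tdist1 K (cubn i) (cubn j) ≤ κ' * ds i j)
    (hcs' : 0 ≤ cs') (hsite' : ∀ i, ∑ j, Real.exp (-((κc - κ') * ds i j)) ≤ cs')
    (hκ₁₀ : 0 ≤ c₀.κ₁) (hr : 0 ≤ r) (hμ : 0 ≤ μ) (hμε : 3 * μ ≤ ε₀) (hμκ : 4 * μ ≤ κ₀) (hwin : κ₀ + μ ≤ ρ₀ - ε₀)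
    (hcμ : 0 ≤ cμ) (hrow : RowSum (toB6 (torusGeom K 0 0 0) 0 True) μ cμ)
    (hq : cμ * (cμ * 1 * (1 * (((nC * (r₁ / M * CK * Real.exp (κ' * r₁)) * (cs' / m)) * Real.exp (c₀.κ₁ * (0 : ℕ))) *
      Real.exp (μ * r) * (nD * cμ))) * cμ) * cμ < 1)
    (cellOf : UT K → TPt d N') (J' : L₀.B → Finset (TPt d N')) (hJ' : ∀ b, J' b ⊆ (L₀.dom b).image cellOf)
    (hJ'X : ∀ b, (J' b).Nonempty → (L₀.dom b ∩ X).Nonempty) {P : ℕ} {r₀ Rb : ℝ} (hr₀ : 0 < r₀) (hRD : r₀ + r ≤ Rb)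
    (hpack : ∀ a : UT K, ∃ S : Finset (TPt d N'), S.card ≤ P ∧ ∀ z, tdist1 K a z ≤ Rb → cellOf z ∈ S)
    (hκ₁ : 0 ≤ c.κ₁) (hshift : c.κ₁ * (P / r₀) ≤ ε₀ - 5 * μ)
    -- the tail
    (hK1an : ∀ i j, DifferentiableOn ℂ (fun u => K1 u i j) (ball (0 : E) R))
    (hK1bd : ∀ u ∈ ball (0 : E) R, ∀ y y', blockNorm cubn cubn (K1 u) y y' ≤ lam1 * Real.exp (-(ρV * tdist1 K y y')))
    (hlam1 : 0 ≤ lam1) (hρV : ρ₀ - 2 * μ - c.κ₁ * (P / r₀) ≤ ρV)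
    (hKW : Real.exp (c.κ₁ * P) * (Real.exp ((ε₀ - 3 * μ) * (2 * r)) *
          (cμ * (((cs' / m) * Real.exp (c₀.κ₁ * (0 : ℕ))) * Real.exp (μ * r) * (nD * cμ)) *
            (1 * (1 - cμ * (cμ * 1 * (1 * (((nC * (r₁ / M * CK * Real.exp (κ' * r₁)) * (cs' / m)) *
              Real.exp (c₀.κ₁ * (0 : ℕ))) * Real.exp (μ * r) * (nD * cμ))) * cμ) * cμ)⁻¹) * cμ)) ≤ KW)
    (hqt : cμ * (cμ * 1 * (1 * (cμ * lam1 * KW * cμ)) * cμ) * cμ < 1) :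
    ∃ (W₀ : Type) (T₀ : W₀ → (TPt d N' → ℂ) → E → Matrix n n ℂ) (dec₀ : W₀ → Finset (TPt d N'))
      (W : Type) (T : W → (TPt d N' → ℂ) → E → Matrix n n ℂ) (SX : Set W) (A : W → ℝ) (D : W → UT K → UT K → ℝ),
      BlockWalkExpansion c cubn cubn (fun σ u => decKernel T₀ dec₀ σ u * (1 + K1 u * decKernel T₀ dec₀ σ u)⁻¹) X R
        (ε₀ - 3 * μ - c.κ₁ * (P / r₀) - 2 * μ) (κ₀ - 2 * μ - 2 * μ)
        (cμ * KW * (1 * (1 - cμ * (cμ * 1 * (1 * (cμ * lam1 * KW * cμ)) * cμ) * cμ)⁻¹) * cμ) T SX A D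
        (ρ₀ - 3 * μ - c.κ₁ * (P / r₀) - 2 * μ) ∧
      (∀ u ∈ ball (0 : E) R, decKernel T₀ dec₀ (fun _ => 1) u =
        (withOp L₀ fun b u => Hd h b * extend (compress (1 + K0 u) (Es b))⁻¹ * Hd h b).kernel (fun _ => 1) u *
          ((1 : Matrix n n ℂ) + (-1 : ℂ) •
            (withOp L₀ fun b u =>
              (Hd h b * K0 u - K0 u * Hd h b) * extend (compress (1 + K0 u) (Es b))⁻¹ * Hd h b).kernel (fun _ => 1) u)⁻¹) ∧
      (∀ u ∈ ball (0 : E) R, ∀ y y', blockNorm cubn cubn (decKernel T₀ dec₀ (fun _ => 1) u) y y' ≤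
        KW * Real.exp (-((κ₀ - 2 * μ) * tdist1 K y y'))) ∧
      ∀ ω, DomBy (toB6 (torusGeom K 0 0 0) 0 True) (D ω) := by
  obtain ⟨W₀, T₀, A₀, D₀, dec₀, hB, hker, hdom₀⟩ := accretive_print_rate hanchor hdiam hJ0 hmult hsupp habs hE hKan hKbd hCK hM
    hr₁ hsymm hd0 hLip hKrange hdomE hcard hm hκc hcoer hκ' hcmp hcs' hsite' hκ₁₀ hr hμ hμε (by linarith) hwin hcμ hrow hq cellOf
    J' hJ' hJ'X hr₀ hRD hpack hκ₁ (by linarith)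
  have hq1 : 0 < 1 - cμ * (cμ * 1 * (1 * (((nC * (r₁ / M * CK * Real.exp (κ' * r₁)) * (cs' / m)) *
      Real.exp (c₀.κ₁ * (0 : ℕ))) * Real.exp (μ * r) * (nD * cμ))) * cμ) * cμ := by linarith
  have hK0 : 0 ≤ Real.exp (c.κ₁ * P) * (Real.exp ((ε₀ - 3 * μ) * (2 * r)) *
      (cμ * (((cs' / m) * Real.exp (c₀.κ₁ * (0 : ℕ))) * Real.exp (μ * r) * (nD * cμ)) *
        (1 * (1 - cμ * (cμ * 1 * (1 * (((nC * (r₁ / M * CK * Real.exp (κ' * r₁)) * (cs' / m)) *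
          Real.exp (c₀.κ₁ * (0 : ℕ))) * Real.exp (μ * r) * (nD * cμ))) * cμ) * cμ)⁻¹) * cμ)) := by
    have := hm.le; positivity
  have hB' := blockWalkExpansion_mono_const hB hKW
  obtain ⟨W, T, SX, A, D, hT, hdomT⟩ := blockWalkExpansion_tail hB' hdom₀ hlam1 hK1an hK1bd hμ (by linarith) (by linarith)
    (by linarith) (by linarith) (hK0.trans hKW) hcμ hrow hqt
  have h1 : ∀ j : TPt d N', ‖(fun _ : TPt d N' => (1 : ℂ)) j‖ ≤ Real.exp c.κ₁ := fun _ => by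
    rw [norm_one]; exact Real.one_le_exp hκ₁
  exact ⟨W₀, T₀, dec₀, W, T, SX, A, D, hT, hker,
    fun u hu y y' => blockNorm_kernel_le hB' (by linarith) (fun _ => 1) h1 u hu y y', hdomT⟩

/-- **… AND AT `s ≡ 1` THE KERNEL IS `Δ′(u)⁻¹ = (1 + K′₀(u) + K′₁(u))⁻¹`, EVERY INVERTIBILITY LETTER DISCHARGED**: with `Σ_□h_□² = 1`,
the covering multiplicity `n_B` and `n_Bn_Cλ_R < 1` (48: `1 − R(u)` invertible, so `W(1,u) = (1 + K′₀(u))⁻¹`), `1 + K′₀(u)` a unit by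
its conjugated coercivity, and `1 + K′₁(u)W(1,u)` a unit by §2 (`λ₁c_μK_Wc_μ < 1`, implied by the tail margin since `c_μ ≥ 1`):
`W(1,u)(1 + K′₁(u)W(1,u))⁻¹ = (1 + K′₀(u) + K′₁(u))⁻¹` on the ball (49's `tail_kernel_one`).  (`c₀`: any tag constants for the
untagged step family's letter, through which 48's Gershgorin discharge is routed.)
[cite: Balaban1985BackgroundPropagators, (3.88)–(3.90) p.409, (3.96) p.411, (3.130) p.421–422; Balaban1988RG2Cluster, p.3] -/
theorem accretive_tail_one_eq_inv (c₀ : B13.Consts) {W₀ : Type} {T₀ : W₀ → (TPt d N' → ℂ) → E → Matrix n n ℂ}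
    {dec₀ : W₀ → Finset (TPt d N')} {κW : ℝ}
    (hker : ∀ u ∈ ball (0 : E) R, decKernel T₀ dec₀ (fun _ => 1) u =
      (withOp L₀ fun b u => Hd h b * extend (compress (1 + K0 u) (Es b))⁻¹ * Hd h b).kernel (fun _ => 1) u *
        ((1 : Matrix n n ℂ) + (-1 : ℂ) •
          (withOp L₀ fun b u =>
            (Hd h b * K0 u - K0 u * Hd h b) * extend (compress (1 + K0 u) (Es b))⁻¹ * Hd h b).kernel (fun _ => 1) u)⁻¹)
    (hWbd : ∀ u ∈ ball (0 : E) R, ∀ y y', blockNorm cubn cubn (decKernel T₀ dec₀ (fun _ => 1) u) y y' ≤ KW * Real.exp (-(κW * tdist1 K y y')))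
    (hKW : 0 ≤ KW)
    -- 47's primitive letters for `K′₀` (the step family's decaying letter is rebuilt from them as in 47's END)
    (hanchor : ∀ b, L₀.anchor b ∈ L₀.dom b) (hdiam : ∀ b, ∀ z ∈ L₀.dom b, ∀ z' ∈ L₀.dom b, tdist1 K z z' ≤ r)
    (hJ0 : ∀ b, L₀.J b = ∅) (hmult : ∀ z : UT K, (Finset.univ.filter fun b => L₀.anchor b = z).card ≤ nD)
    (hsum : ∀ y, ∑ b, h b y ^ 2 = 1) (hsupp : ∀ b y, y ∉ Es b → h b y = 0) (habs : ∀ b y, |h b y| ≤ 1)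
    (hE : ∀ b y, y ∈ Es b → cubn y ∈ L₀.dom b)
    (hKan : ∀ i j, DifferentiableOn ℂ (fun u => K0 u i j) (ball (0 : E) R))
    (hKbd : ∀ u ∈ ball (0 : E) R, ∀ y y', blockNorm cubn cubn (K0 u) y y' ≤ CK) (hCK : 0 ≤ CK)
    (hM : 0 < M) (hr₁ : 0 ≤ r₁) (hsymm : ∀ i j, ds i j = ds j i) (hd0 : ∀ j, ds j j = 0)
    (hLip : ∀ b i j, |h b i - h b j| ≤ ds i j / M) (hKrange : ∀ u i j, K0 u i j ≠ 0 → ds i j ≤ r₁)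
    (hdomE : ∀ b i, (∃ k ∈ Es b, ds i k ≤ r₁) → cubn i ∈ L₀.dom b)
    (hcard : ∀ b, (L₀.dom b).card ≤ nC) (hcov : ∀ y : UT K, (Finset.univ.filter fun b => y ∈ L₀.dom b).card ≤ nB)
    (hm : 0 < m) (hκc : 0 ≤ κc)
    (hcoer : ∀ u ∈ ball (0 : E) R, ∀ j, ∀ z : n → ℂ, m * nsq z ≤ (conjForm (1 + K0 u) κc (fun e => ds e j) z).re)
    (hκ' : 0 ≤ κ') (hρ₀ : 0 ≤ ρ₀) (hcmp : ∀ i j, ρ₀ * tdist1 K (cubn i) (cubn j) ≤ κ' * ds i j)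
    (hcs' : 0 ≤ cs') (hsite' : ∀ i, ∑ j, Real.exp (-((κc - κ') * ds i j)) ≤ cs')
    (hsmall : (nB : ℝ) * nC * (nC * (r₁ / M * CK * Real.exp (κ' * r₁)) * (cs' / m)) < 1)
    -- the tail's letter and margin
    (hK1bd : ∀ u ∈ ball (0 : E) R, ∀ y y', blockNorm cubn cubn (K1 u) y y' ≤ lam1 * Real.exp (-(ρV * tdist1 K y y')))
    (hlam1 : 0 ≤ lam1) (hrow : RowSum (toB6 (torusGeom K 0 0 0) 0 True) μ cμ) (hμρ : μ ≤ ρV) (hμκ : μ ≤ κW)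
    (hsmallt : lam1 * cμ * (KW * cμ) < 1) :
    ∀ u ∈ ball (0 : E) R, decKernel T₀ dec₀ (fun _ => 1) u * (1 + K1 u * decKernel T₀ dec₀ (fun _ => 1) u)⁻¹ = (1 + K0 u + K1 u)⁻¹ := by
  intro u hu
  -- the step family's decaying block letter, rebuilt from the primitive letters (45's constructor, 36/47's lemmas)
  have hR := isDomainLocalBD_step (L := withOp L₀ fun b u => extend (compress (1 + K0 u) (Es b))⁻¹) (c₀ := c₀)
    hanchor hdiam hJ0 hmult hsupp habs hE
    (fun b i j => differentiableOn_locInv (Es b) ds hm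
      (fun k l => by
        simp only [Matrix.add_apply]
        exact (differentiableOn_const _).add (hKan k l)) hcoer i j)
    (fun b u hu y y' => blockNorm_locInv_le_decay cubn (1 + K0 u) (Es b) ds hd0 hκc hm (hcoer u hu) hcmp hcs' hsite' y y')
    (div_nonneg hcs' hm.le) hρ₀ hKan
    (fun b u hu y y'' => blockNorm_comm_le_decay cubn h ds hM hr₁ hLip (K0 u) (hKrange u) (hKbd u hu) hCK hκ' hcmp b y y'')
    (by positivity)
    (fun b u y y' hne => comm_blocks_subset cubn h Es hsupp ds hsymm (fun i => by rw [hd0]; exact hr₁)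
      (K0 u) (hKrange u) L₀.dom hdomE b y y' hne)
    hcard
  have hW1 : decKernel T₀ dec₀ (fun _ => 1) u = (1 + K0 u)⁻¹ :=
    accretive_print_one_eq_inv_of_small hker hsum hsupp hm hcoer hR hρ₀ (by positivity) hcard hcov hsmall u hu
  -- `1 + K′₀(u)` is a unit by conjugated coercivity (any column weight; the empty index type is trivial)
  have hA : IsUnit (1 + K0 u).det := by
    rcases isEmpty_or_nonempty n with hn | ⟨⟨j⟩⟩
    · rw [Matrix.det_isEmpty]; exact isUnit_one
    · exact (Matrix.isUnit_iff_isUnit_det _).1 (isUnit_of_conjCoercive hm (hcoer u hu j))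
  have hAW : (1 + K0 u) * decKernel T₀ dec₀ (fun _ => 1) u = 1 := by rw [hW1, Matrix.mul_nonsing_inv _ hA]
  have hunit : IsUnit (1 + K1 u * decKernel T₀ dec₀ (fun _ => 1) u).det :=
    isUnit_det_one_add_mul_of_small cubn (K1 u) (decKernel T₀ dec₀ (fun _ => 1) u) hlam1 hKW (hK1bd u hu) (hWbd u hu) hrow hμρ hμκ hsmallt
  exact tail_kernel_one (1 + K0 u) (decKernel T₀ dec₀ (fun _ => 1) u) (K1 u) hAW hunit

end End

end Summit.QuantumFields.BalabanUV.Gaps.D4WalkBlockAccretiveTail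

end
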